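import Summits.MatrixMultiplication.OmegaCensus.DihC3SqTPP

/-!
# ω-census, family (b3): the class `𝒞₂` — the member `Dih(C₃²)`, products with abelian groups, and the census cell `(18,3,3) @ 90`

HONEST FRAMING (pub-omega census; verbatim): lottery ticket; floor = certified bounds/negative ranges.
Census BOOKKEEPING (prereg P-031.3, session B, file B3 — scaffold by pub-omega stpp-1 gen 14, filed by gen 17; the hand-built group
`Dih(C₃²)` = `DihC3C3` and its coordinates now live in `DihC3SqDih`): the closure of the class under `× A` (`A` abelian,
`Coord2.prod`), the LAW "no `⟨N, 3, 3⟩` in `Dih(C₃²) × A` in any order when `32|A| < 9N`" (`16·18|A| < 81N`) and the cell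
`(18, 3, 3) ∉ Dih(C₃²) × C₅` (order `90`: `81·18 = 1458 > 1440 = 16·90`).  A certified NEGATIVE RANGE for single TPP triples;
nothing here is progress on `ω`.
-/

namespace Summit.MatrixMultiplication.OmegaCensus.DihC3Sq

namespace Coord2

/-- Coordinates pass to `Q × A` for abelian `A` (the class `𝒞₂` is closed under such products). [folklore] -/
theorem prod {Q A : Type*} [Group Q] [CommGroup A] {c₁ c₂ : Q} {κ₁ κ₂ ε : Q → ZMod 3} (h : Coord2 c₁ c₂ κ₁ κ₂ ε) :
    Coord2 ((c₁, 1) : Q × A) (c₂, 1) (fun q => κ₁ q.1) (fun q => κ₂ q.1) (fun q => ε q.1) := by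
  refine ⟨Prod.ext (by simp [h.c1_cube]) (by simp), Prod.ext (by simp [h.c2_cube]) (by simp),
    Prod.ext (by simp [h.c_comm]) (by simp), h.kap1_c1, h.kap2_c1, h.kap1_c2, h.kap2_c2, fun g => h.sign g.1,
    fun g k => h.kap1_mul g.1 k.1, fun g k => h.kap2_mul g.1 k.1, fun g k => h.eps_mul g.1 k.1, fun x y => ?_⟩
  obtain ⟨u, hu, e⟩ := h.comm x.1 y.1
  refine ⟨(u, 1), ?_, Prod.ext e (by rw [Prod.snd_mul, Prod.snd_mul, Prod.snd_mul, mul_one, mul_comm])⟩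
  rcases hu with rfl | rfl | rfl | rfl | rfl | rfl | rfl | rfl | rfl <;> simp [InK2, Prod.ext_iff]

end Coord2

/-- **Law for `Dih(C₃²) × A`** (`A` finite abelian): no `⟨N, 3, 3⟩` in any order when `32|A| < 9N` (`16·18|A| < 81N`). [folklore] -/
theorem DihC3C3_prod_no_tpp_three_three {A : Type*} [CommGroup A] [Fintype A] [DecidableEq A] (N : ℕ)
    (hlt : 32 * Fintype.card A < 9 * N) :
    ¬ Literature.Computability.AlgebraicComplexity.RealizesTPP (DihC3C3 × A) N 3 3 ∧
      ¬ Literature.Computability.AlgebraicComplexity.RealizesTPP (DihC3C3 × A) 3 N 3 ∧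
        ¬ Literature.Computability.AlgebraicComplexity.RealizesTPP (DihC3C3 × A) 3 3 N :=
  DihC3C3.coord2.prod.not_realizesTPP_three_three N
    (by rw [Fintype.card_prod, show Fintype.card DihC3C3 = 18 by rfl]; omega)

/-- **Census cell `(18, 3, 3)` at order `90` in `Dih(C₃²) × C₅`** (`81·18 = 1458 > 1440 = 16·90`): not realized, in any order —
the first cell of the class below Neumann's bound (`5·18 = 90 ≤ 90`). [folklore] -/
theorem DihC3C3xC5_no_tpp_18_3_3 :
    ¬ Literature.Computability.AlgebraicComplexity.RealizesTPP (DihC3C3 × Multiplicative (ZMod 5)) 18 3 3 ∧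
      ¬ Literature.Computability.AlgebraicComplexity.RealizesTPP (DihC3C3 × Multiplicative (ZMod 5)) 3 18 3 ∧
        ¬ Literature.Computability.AlgebraicComplexity.RealizesTPP (DihC3C3 × Multiplicative (ZMod 5)) 3 3 18 :=
  DihC3C3_prod_no_tpp_three_three 18 (by simp)


end Summit.MatrixMultiplication.OmegaCensus.DihC3Sq
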